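/-
Copyright (c) 2026 the pub-hodgecm-mathlib formalisation cell (harness21).  Prover seat hodgecm-mathlib-K2Liu-p02 (g6), Track B «K2-LIT» ∕ hLiu418
#184♮, Road I v3 («uniqueness road» for #42F′), unit U5 «THE CLOSE», STEP 0b «PURE TENSORS SUFFICE» (LEAD F0P6-plan (g13) hourly #2
2026-09-04T09:24:21Z; binder sheet `K2/K2E5-plan/g6/SIGS-RoadI-v3.md` §2 U5 «`_hΦ` ⇒ `Φ` is a finite sum of pure tensors», §2 U0.4).
-/
import Literature.NumberTheory.K2Lit.SiegelEisensteinSeriesDoubled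
import Literature.NumberTheory.K2Lit.SiegelStandardSections
import Literature.NumberTheory.K2Lit.SiegelStandardIwasawaData                                   -- ★ `IwasawaDatum.IsStd`
import Literature.NumberTheory.K2Lit.DoubledLineThetaKernel                                       -- ★ D8 `doubledLineThetaLift`, `dD`
import Literature.NumberTheory.Automorphic.AdelicGLnGlue                                            -- ★ `adelicHeightGL` (#41 growth clause)
import Summits.HodgeConjecture.HodgeConjecture.Theorems.K2LiuConjugateSymplecticInv               -- ★ `IsConjugateSymplectic.inv`
import Summits.HodgeConjecture.HodgeConjecture.Theorems.K2LiuSiegelWeilTensorGenerator            -- ★ O42.3g: standard + continuous twisted SW generator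
import Summits.HodgeConjecture.HodgeConjecture.Theorems.K2LiuFirstTermResidueForm                 -- ★ U0: `resNorm`, `resNorm_finset_sum`
import Summits.HodgeConjecture.HodgeConjecture.Theorems.K2LiuDoubledLiftSpanReduction             -- ★ `doubledLineThetaLift_add ∕ _smul`
import Summits.HodgeConjecture.HodgeConjecture.Theorems.K2LiuTensorEmbArchFinParts               -- ★ U2f ⇒: `finiteDimensional_span_orbit_of_mem_span_tmul_of_isStd`
import HarnessLib

/-!
# K2_Liu road (hLiu418 = stmt-HodgeConjecture-24832), Road I v3, unit U5 «THE CLOSE», STEP 0b: ON A RIGIDITY DOMAIN THE RESIDUE-IN-IMAGE FACE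
# FOR PURE TENSORS IMPLIES IT FOR THE WHOLE DOMAIN — `‹#41› → ‹FACE-P› → ‹FACE-D›`

Cell `pub/hodgecm-mathlib` (D-0151), Track B, build stream 29.  Companion of STEP 0a `K2LiuFirstTermIdentityDomainReduction`
(`‹FACE-D› → ‹#42F′›`).  FACE-D asks, on a rigidity domain `D_V = span{E(a ⊗ Φ_f) : a ∈ V}` (`V ≤ 𝓢((L⁺ ⊗ ℝ)^{n′+n′})` finite-dimensional and
stable slot-wise under the archimedean elements of `𝒦.K`), that the normalised residue `resNorm Pg Eg` of every pole-cleared continuation of the Siegel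
Eisenstein series of the twisted Siegel–Weil generator `g_Φ`, `Φ ∈ D_V`, be a doubled line theta lift `B(Φ′)` from ONE line `a′` with ONE theta datum.
**FACE-P** is the same statement for the PURE TENSORS `Φ = E(a ⊗ Φ_f)`, `a ∈ V`, only.  Since everything in sight is `ℂ`-linear — the generator
`Φ ↦ g_Φ` (★ `swSectionTensor_add ∕ _smul`, ★ `stdExtension` pointwise), the residue form `f ↦ resNorm` along ADMISSIBLE continuations (★ U0.4
`K2LiuFirstTermResidueForm.resNorm_finset_sum`, which needs a continuation of EACH summand: socket #41 BY VALUE, applicable because every pure tensor of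
`D_V` is again `K`-finite by ★ U2f ⇒ `K2LiuTensorEmbArchFinParts.finiteDimensional_span_orbit_of_mem_span_tmul_of_isStd` and hence its generator is a
STANDARD continuous family by ★ O42.3g `K2LiuSiegelWeilTensorGenerator`), and the lift `Φ′ ↦ B(Φ′)` (★ `K2LiuDoubledLiftSpanReduction.doubledLineThetaLift_add ∕
_smul`) — FACE-P and #41 give FACE-D with `Φ′ := Σ_j c_j • Φ′_j` along any decomposition `Φ = Σ_j c_j • E(a_j ⊗ Φ_{f,j})` (Mathlib `Submodule.mem_span_set'`).

* §1 `doubledLineThetaLift_sum_smul` — `B(Σ_j c_j • Φ′_j) = Σ_j c_j · B(Φ′_j)` pointwise (finite sums; ★ `_add`, `_smul`).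
* §2 `swSectionTensor_sum_smul`, `twistedGen_sum_smul` — the socket's generator family `g_Φ` is `ℂ`-linear in `Φ` (as a function `ℂ → H(𝔸) → ℂ`).
* §3 **`domainFace_of_pureFace : ‹#41 :289 verbatim› → ‹FACE-P› → ‹FACE-D›`** (FACE-D bytes = STEP 0a's hypothesis).

So the closer owes FACE-P only: for the payer (★ U2 `rankOneRigidity` on `D_V`) the two forms cost the same, and the pure-tensor form is what the place-by-place
organs (U1, A-int, U4 — SIGS §2) read.  No statement of any socket is changed; nothing here closes #41 or #42F′.

No definition, no instance, no notation, no named-fact hypothesis, no `sorry`; axioms ⊆ {propext, Classical.choice, Quot.sound}.  HONEST LABEL: HC_CM is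
proved only modulo the 7 printed citations (2 remaining named inputs: hLiu418 = stmt-HodgeConjecture-24832, h413 = stmt-HodgeConjecture-24833) until rung 0
closes; this file is a `--supports stmt-HodgeConjecture-24832` helper and moves no counter.

References: [KudlaRallis1994] S. Kudla, S. Rallis, Ann. of Math. 140 (1994) §1 Thm. 1.1; [HarrisKudlaSweet1996] M. Harris, S. Kudla, W. J. Sweet, J. AMS 9
(1996) §1 (1.15)–(1.17), proof of Lem. 1.1; [Weil1964] A. Weil, Acta Math. 111 (1964) Chap. III n° 41 Thm 6 (linearity of the theta distribution);
[Liu2021] Y. Liu, Camb. J. Math. 9 (2021) App. B (B.7), Lem. B.12; [Tan1999] V. Tan, Canad. J. Math. 51 (1999) §1.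
-/

set_option autoImplicit false
set_option linter.dupNamespace false

noncomputable section

open scoped Matrix Topology TensorProduct SchwartzMap Classical  -- `Classical`: the `Fintype` of real ∕ complex places inside `mixedSpace (L⁺)` (as in ★ U2f)
open NumberField NumberField.mixedEmbedding IsDedekindDomain MeasureTheory Filter

namespace Summit.HodgeConjecture.HodgeConjecture.Cruxes.HLiu418.K2LiuFirstTermIdentityPureTensorReduction

open Literature.NumberTheory.Automorphic Literature.NumberTheory.Automorphic.UnitaryGroup Literature.NumberTheory.GaloisRepresentations
open Literature.NumberTheory.GelbartRogawski1991 Literature.NumberTheory.GelbartRogawski1991.GRConstruction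
open Literature.NumberTheory.GelbartRogawski1991.GRConstruction.DoubledWeilDetTwist
open Literature.NumberTheory.GelbartRogawski1991.UnitaryDualPair
open Literature.NumberTheory.K2Lit.SiegelDoubled Literature.NumberTheory.K2Lit.DoubledLineTheta
open Literature.NumberTheory.Automorphic.IdeleClassGroup
open Literature.NumberTheory.Automorphic.Liu2021
open Literature.NumberTheory.Automorphic.Liu2021.Def411WeilCarriers
open Literature.NumberTheory.Automorphic.Liu2021.Def411WeilCarriersDoubling
open Literature.NumberTheory.Weil1964
open Literature.RepresentationTheory.Liu2021
open Literature.RepresentationTheory.HarrisKudlaSweet1996 (IsSplittingChar)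
open Summit.HodgeConjecture.HodgeConjecture.Cruxes.HLiu418.K2LiuFirstTermResidueFormDefs (resNorm)
open Summit.HodgeConjecture.HodgeConjecture.Cruxes.HLiu418.K2LiuFirstTermResidueForm (resNorm_finset_sum)
open Summit.HodgeConjecture.HodgeConjecture.Cruxes.HLiu418.K2LiuDoubledLiftSpanReduction (doubledLineThetaLift_add doubledLineThetaLift_smul)
open Summit.HodgeConjecture.HodgeConjecture.Cruxes.HLiu418.K2LiuSiegelWeilTensorGenerator
  (isStandardSectionFamily_swTensorTwisted continuous_swTensorTwisted)
open Summit.HodgeConjecture.HodgeConjecture.Cruxes.HLiu418.K2LiuTensorEmbArchFinParts (finiteDimensional_span_orbit_of_mem_span_tmul_of_isStd)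

/-! ## §1 The doubled line theta lift of a finite combination -/

section Lift

variable (L : Type) [Field L] [NumberField L] [IsCMField L]
variable {N n : ℕ} (e : Fin N × Fin 1 ≃ Fin n)
  (dV : Fin N → L) (hdV : ∀ i, IsCMField.complexConj L (dV i) = dV i)
  (dW : Fin 1 → L) (hdW : ∀ i, IsCMField.complexConj L (dW i) = dW i)
  {n'' : ℕ} (e₁ : Fin (n + n) × Fin 1 ≃ Fin n'')
  (hdV0 : ∀ i, dV i ≠ 0) (hdW0 : ∀ i, dW i ≠ 0)
  (lam : Literature.NumberTheory.Automorphic.IdeleClassGroup L →ₜ* Circle) (hlam : IsConjugateSymplectic L lam) (a' : (Fp L)ˣ)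
  (hρ : HasThetaMajorants fun
      (p : ↥(UnitaryGroup.adelic (Fp L) L (IsCMField.complexConj L) (n + n) (Matrix.diagonal (dD L e dV hdV dW hdW))) ×
        ↥(UnitaryGroup.adelic (Fp L) L (IsCMField.complexConj L) 1 (JW (Fp L) L a')))
      (Φ : piSchwartzBruhat (Fp L) (Fin n'')) =>
        pairRep (Fp L) L (IsCMField.complexConj L) (n + n) 1 e₁ (Matrix.diagonal (dD L e dV hdV dW hdW)) (JW (Fp L) L a')
          (chiSplittingLine L e₁ (dD L e dV hdV dW hdW) (dD_conj L e dV hdV dW hdW) (dD_ne_zero L e dV hdV dW hdW hdV0 hdW0)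
            (toHeckeCharacter L lam) (isUnitary_toHeckeCharacter L lam)
            ((isOscillatorChar_toHeckeCharacter_iff lam).mpr hlam) (TW (Fp L) a')
            (isUnit_det_TW (Fp L) a') (JW (Fp L) L a') (JW_eq (Fp L) L a'))
          p Φ)
  [MeasurableSpace (↥(UnitaryGroup.adelic (Fp L) L (IsCMField.complexConj L) 1 (JW (Fp L) L a')) ⧸
    (UnitaryGroup.toAdelic (Fp L) L (IsCMField.complexConj L) 1 (JW (Fp L) L a')).range)]
  [BorelSpace (↥(UnitaryGroup.adelic (Fp L) L (IsCMField.complexConj L) 1 (JW (Fp L) L a')) ⧸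
    (UnitaryGroup.toAdelic (Fp L) L (IsCMField.complexConj L) 1 (JW (Fp L) L a')).range)]
  (μW : Measure (↥(UnitaryGroup.adelic (Fp L) L (IsCMField.complexConj L) 1 (JW (Fp L) L a')) ⧸
    (UnitaryGroup.toAdelic (Fp L) L (IsCMField.complexConj L) 1 (JW (Fp L) L a')).range)) [IsFiniteMeasure μW]
  (f : C(↥(UnitaryGroup.adelic (Fp L) L (IsCMField.complexConj L) 1 (JW (Fp L) L a')) ⧸
    (UnitaryGroup.toAdelic (Fp L) L (IsCMField.complexConj L) 1 (JW (Fp L) L a')).range, ℂ))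

/-- **`B(Σ_{j∈s} c_j • Φ_j)(h) = Σ_{j∈s} c_j · B(Φ_j)(h)`** — the doubled line theta lift of a finite combination (induction on `s` over ★
`doubledLineThetaLift_add` ∕ `doubledLineThetaLift_smul`; the empty sum by `B(0 • 0) = 0 · B(0)`). [cite: Weil1964, Chap. III n° 41 Thm 6 p. 193]
[cite: Liu2021, App. B (B.7) p. 104] -/
theorem doubledLineThetaLift_sum_smul {ι : Type*} (s : Finset ι) (c : ι → ℂ) (Φ : ι → piSchwartzBruhat (Fp L) (Fin n''))
    (h : HA L e dV hdV dW hdW) :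
    doubledLineThetaLift L e dV hdV dW hdW e₁ hdV0 hdW0 lam hlam a' hρ μW (∑ j ∈ s, c j • Φ j) f h =
      ∑ j ∈ s, c j * doubledLineThetaLift L e dV hdV dW hdW e₁ hdV0 hdW0 lam hlam a' hρ μW (Φ j) f h := by
  induction s using Finset.induction_on with
  | empty =>
    rw [Finset.sum_empty, Finset.sum_empty, ← zero_smul ℂ (0 : piSchwartzBruhat (Fp L) (Fin n'')),
      doubledLineThetaLift_smul, zero_mul]
  | insert j s hj ih =>
    rw [Finset.sum_insert hj, Finset.sum_insert hj, doubledLineThetaLift_add, doubledLineThetaLift_smul, ih]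

end Lift

/-! ## §2 The socket's generator family `g_Φ` is `ℂ`-linear in `Φ` -/

section Generator

variable (L : Type) [Field L] [NumberField L] [IsCMField L]
variable {N M n : ℕ} (e : Fin N × Fin M ≃ Fin n)
  (dV : Fin N → L) (hdV : ∀ i, IsCMField.complexConj L (dV i) = dV i) (hdV0 : ∀ i, dV i ≠ 0)
  (dW : Fin M → L) (hdW : ∀ i, IsCMField.complexConj L (dW i) = dW i) (hdW0 : ∀ i, dW i ≠ 0)
variable {M₂ M' n' : ℕ} (eW : Fin M × Fin M₂ ≃ Fin M') (e' : Fin N × Fin M' ≃ Fin n')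
  (dV' : Fin M₂ → L) (hdV' : ∀ k, IsCMField.complexConj L (dV' k) = dV' k) (hdV'0 : ∀ k, dV' k ≠ 0)
  (sB : HA L e' dV hdV (tensorFrame L dW eW dV') (tensorFrame_real L dW hdW eW dV' hdV') →*
    MpD L e' dV hdV (tensorFrame L dW eW dV') (tensorFrame_real L dW hdW eW dV' hdV'))

/-- **`f^{V′}_{Σ c_j • Φ_j}(h) = Σ c_j · f^{V′}_{Φ_j}(h)`** — the Siegel–Weil section of an `M₂`-frame is `ℂ`-linear in `Φ` (finite sums; ★ `swSectionTensor_add`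
∕ `_smul`). [cite: KudlaRallis1994, §1] [cite: HarrisKudlaSweet1996, §1 (1.16)] -/
theorem swSectionTensor_sum_smul {ι : Type*} (s : Finset ι) (c : ι → ℂ) (Φ : ι → piSchwartzBruhat (Fp L) (Fin (n' + n')))
    (h : HA L e dV hdV dW hdW) :
    swSectionTensor L e dV hdV dW hdW eW e' dV' hdV' hdV0 hdW0 hdV'0 sB (∑ j ∈ s, c j • Φ j) h =
      ∑ j ∈ s, c j * swSectionTensor L e dV hdV dW hdW eW e' dV' hdV' hdV0 hdW0 hdV'0 sB (Φ j) h := by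
  induction s using Finset.induction_on with
  | empty =>
    rw [Finset.sum_empty, Finset.sum_empty, ← zero_smul ℂ (0 : piSchwartzBruhat (Fp L) (Fin (n' + n'))),
      swSectionTensor_smul, zero_mul]
  | insert j s hj ih =>
    rw [Finset.sum_insert hj, Finset.sum_insert hj, swSectionTensor_add, swSectionTensor_smul, ih]

/-- **THE SOCKET'S GENERATOR FAMILY IS `ℂ`-LINEAR IN `Φ`**: `g_{Σ_j c_j • Φ_j} = Σ_j c_j • g_{Φ_j}` as functions `ℂ → H(𝔸) → ℂ`, where
`g_Φ(s, h) = α(det h) · stdExtension 𝒦 s₀ (f^{V′}_Φ) s h` (any `sB`, `𝒦`, `s₀`, `α`; §2 `swSectionTensor_sum_smul` + ★ `stdExtension` pointwise).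
[cite: KudlaRallis1994, §1] [cite: HarrisKudlaSweet1996, §1 (1.15)–(1.17)] -/
theorem twistedGen_sum_smul (𝒦 : IwasawaDatum L e dV hdV dW hdW) (s₀ : ℂ) (α : UnitaryGroup.adelicOne (Fp L) L (IsCMField.complexConj L) →* ℂˣ)
    {m : ℕ} (c : Fin m → ℂ) (Φ : Fin m → piSchwartzBruhat (Fp L) (Fin (n' + n'))) :
    (fun z h => ((detChar L e dV hdV hdV0 dW hdW hdW0 α h : ℂˣ) : ℂ) *
        stdExtension 𝒦 s₀ (swSectionTensor L e dV hdV dW hdW eW e' dV' hdV' hdV0 hdW0 hdV'0 sB (∑ j, c j • Φ j)) z h) =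
      ∑ j, c j • fun z h => ((detChar L e dV hdV hdV0 dW hdW hdW0 α h : ℂˣ) : ℂ) *
        stdExtension 𝒦 s₀ (swSectionTensor L e dV hdV dW hdW eW e' dV' hdV' hdV0 hdW0 hdV'0 sB (Φ j)) z h := by
  funext z h
  simp only [Finset.sum_apply, Pi.smul_apply, smul_eq_mul, stdExtension]
  rw [swSectionTensor_sum_smul, Finset.mul_sum, Finset.mul_sum]
  exact Finset.sum_congr rfl fun j _ => by ring

end Generator

/-! ## §3 `‹#41› → ‹FACE-P› → ‹FACE-D›` -/

set_option maxHeartbeats 1600000 in -- #41 + FACE-P + FACE-D by value in ONE statement and `m` K-finite generators in the proof (measured: default 200000 times out at `whnf`)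
/-- **U5 STEP 0b — ON A RIGIDITY DOMAIN, THE RESIDUE-IN-IMAGE FACE FOR PURE TENSORS IMPLIES IT FOR THE WHOLE DOMAIN.**  Hypotheses: `h41` = the statement of
socket #41 `sig_K2LiuSiegelEisensteinContinuation` (U6 ED. 12 :289) BY VALUE, and **FACE-P** = «for the frame data of #42F′ and every enumeration `e₁` of the
doubled frame there are a line `a′` and ONE theta datum `(hρ, μW, fw)` such that for every finite-dimensional arch-stable `V`, every PURE TENSOR `E(a ⊗ Φ_f)`,
`a ∈ V`, and every pole-cleared continuation `(Pg, Eg)` of `E^Δ(s; g_{E(a ⊗ Φ_f)})` there is `Φ′` with `resNorm Pg Eg = B(a′, hρ, μW, Φ′, fw)`»; conclusion =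
**FACE-D** (the same for every `Φ ∈ D_V = span{E(a ⊗ Φ_f) : a ∈ V}`; bytes = STEP 0a's hypothesis).  Proof: decompose `Φ = Σ_j c_j • E(a_j ⊗ Φ_{f,j})`
(`Submodule.mem_span_set'`); each generator `g_j` is STANDARD and continuous (★ U2f ⇒ + ★ O42.3g, character rewritten along `_hχD`), so `h41` gives a
continuation `(P_j, E_j)` and FACE-P a datum `Φ′_j`; ★ U0.4 `resNorm_finset_sum` (with the given `(Pg, Eg)` for `g_Φ = Σ c_j • g_j`, §2) and §1 give
`resNorm Pg Eg = Σ c_j · B(Φ′_j) = B(Σ c_j • Φ′_j)`. [cite: KudlaRallis1994, §1 Thm. 1.1] [cite: HarrisKudlaSweet1996, §1 (1.15)–(1.17), proof of Lem. 1.1]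
[cite: Weil1964, Chap. III n° 41 Thm 6 p. 193] [cite: Liu2021, App. B Lem. B.12 pp. 103–104] -/
theorem domainFace_of_pureFace
    (h41 : ∀ (L : Type) [Field L] [NumberField L] [IsCMField L] {n : ℕ} (e : Fin 2 × Fin 1 ≃ Fin n)
      (dV : Fin 2 → L) (hdV : ∀ i, IsCMField.complexConj L (dV i) = dV i) (hdV0 : ∀ i, dV i ≠ 0)
      (dW : Fin 1 → L) (hdW : ∀ i, IsCMField.complexConj L (dW i) = dW i) (hdW0 : ∀ i, dW i ≠ 0)
      (lam : Literature.NumberTheory.Automorphic.IdeleClassGroup L →ₜ* Circle) (hlam : IsConjugateSymplectic L lam),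
      HasWeight L lam 1 →
      ∀ (𝒦 : IwasawaDatum L e dV hdV dW hdW) (_h𝒦 : 𝒦.IsStd) (f : ℂ → HA L e dV hdV dW hdW → ℂ),
        IsStandardSectionFamily 𝒦 (toHeckeCharacter L lam⁻¹) f → (∀ s, Continuous (f s)) →
      ∃ (P : Finset ℂ) (Es : ℂ → HA L e dV hdV dW hdW → ℂ),
        (∀ h : HA L e dV hdV dW hdW, DifferentiableOn ℂ (fun s => Es s h) {s : ℂ | 0 < s.re}) ∧
        (∀ s : ℂ, 0 < s.re → Continuous (Es s)) ∧
        (∀ s : ℂ, 0 < s.re → ∀ (γ : ratH L e dV hdV dW hdW) (h : HA L e dV hdV dW hdW),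
          Es s ((γ : HA L e dV hdV dW hdW) * h) = Es s h) ∧
        (∀ (s : ℂ) (h : HA L e dV hdV dW hdW), (n : ℝ) / 2 < s.re →
          Es s h = (∏ p ∈ P, (s - p)) * eisensteinFamilyDelta L e dV hdV dW hdW f s h) ∧
        (∀ z : ℂ, 0 < z.re → ∃ C A r : ℝ, 0 < r ∧ ∀ s : ℂ, dist s z < r → ∀ h : HA L e dV hdV dW hdW,
          ‖Es s h‖ ≤ C * adelicHeightGL (n + n) L (h : GL (Fin (n + n)) (AdeleRing (𝓞 L) L)) ^ A))
    (hP : ∀ (L : Type) [Field L] [NumberField L] [IsCMField L] {n : ℕ} (e : Fin 2 × Fin 1 ≃ Fin n)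
      (dV : Fin 2 → L) (hdV : ∀ i, IsCMField.complexConj L (dV i) = dV i) (hdV0 : ∀ i, dV i ≠ 0)
      (dW : Fin 1 → L) (hdW : ∀ i, IsCMField.complexConj L (dW i) = dW i) (hdW0 : ∀ i, dW i ≠ 0)
      (lam : Literature.NumberTheory.Automorphic.IdeleClassGroup L →ₜ* Circle) (hlam : IsConjugateSymplectic L lam),
      HasWeight L lam 1 →
      ∀ {M' n' : ℕ} (eW : Fin 1 × Fin 3 ≃ Fin M') (e' : Fin 2 × Fin M' ≃ Fin n')
        (dV' : Fin 3 → L) (hdV' : ∀ k, IsCMField.complexConj L (dV' k) = dV' k) (hdV'0 : ∀ k, dV' k ≠ 0)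
        (χb : HeckeCharacter L) (hχbu : χb.IsUnitary) (hχbs : Literature.RepresentationTheory.HarrisKudlaSweet1996.IsSplittingChar L 1 χb)
        (α : UnitaryGroup.adelicOne (Fp L) L (IsCMField.complexConj L) →* ℂˣ) (hα : Continuous α)
        (hαrat : ∀ u : UnitaryGroup.adelicOne (Fp L) L (IsCMField.complexConj L),
          (u : Literature.NumberTheory.GaloisRepresentations.ideleGroup L) ∈ Literature.NumberTheory.GaloisRepresentations.principalIdeles L → α u = 1)
        (_hχD : χb ^ 3 * DoubledWeilDetTwist.ratioHecke L α hα hαrat = toHeckeCharacter L lam⁻¹)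
        (𝒦 : IwasawaDatum L e dV hdV dW hdW) (_h𝒦 : 𝒦.IsStd)
      {n'' : ℕ} (e₁ : Fin (n + n) × Fin 1 ≃ Fin n''),
      ∃ (a' : (↥(maximalRealSubfield L))ˣ)
        (hρ : HasThetaMajorants fun
          (p : ↥(UnitaryGroup.adelic (↥(maximalRealSubfield L)) L (IsCMField.complexConj L) (n + n) (Matrix.diagonal (dD L e dV hdV dW hdW))) ×
            ↥(UnitaryGroup.adelic (↥(maximalRealSubfield L)) L (IsCMField.complexConj L) 1 (JW (↥(maximalRealSubfield L)) L a')))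
          (Ψ : piSchwartzBruhat (↥(maximalRealSubfield L)) (Fin n'')) =>
            pairRep (↥(maximalRealSubfield L)) L (IsCMField.complexConj L) (n + n) 1 e₁ (Matrix.diagonal (dD L e dV hdV dW hdW)) (JW (↥(maximalRealSubfield L)) L a')
              (chiSplittingLine L e₁ (dD L e dV hdV dW hdW) (dD_conj L e dV hdV dW hdW) (dD_ne_zero L e dV hdV dW hdW hdV0 hdW0)
                (toHeckeCharacter L lam⁻¹) (isUnitary_toHeckeCharacter L lam⁻¹)
                ((isOscillatorChar_toHeckeCharacter_iff lam⁻¹).mpr (K2LiuConjugateSymplecticInv.IsConjugateSymplectic.inv hlam)) (TW (↥(maximalRealSubfield L)) a')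
                (isUnit_det_TW (↥(maximalRealSubfield L)) a') (JW (↥(maximalRealSubfield L)) L a') (JW_eq (↥(maximalRealSubfield L)) L a'))
              p Ψ)
        (μW : @Measure (↥(UnitaryGroup.adelic (↥(maximalRealSubfield L)) L (IsCMField.complexConj L) 1 (JW (↥(maximalRealSubfield L)) L a')) ⧸
          (UnitaryGroup.toAdelic (↥(maximalRealSubfield L)) L (IsCMField.complexConj L) 1 (JW (↥(maximalRealSubfield L)) L a')).range) (borel _))
        (fw : C(↥(UnitaryGroup.adelic (↥(maximalRealSubfield L)) L (IsCMField.complexConj L) 1 (JW (↥(maximalRealSubfield L)) L a')) ⧸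
          (UnitaryGroup.toAdelic (↥(maximalRealSubfield L)) L (IsCMField.complexConj L) 1 (JW (↥(maximalRealSubfield L)) L a')).range, ℂ)),
        @IsFiniteMeasure _ (borel _) μW ∧
        @SMulInvariantMeasure
          ↥(UnitaryGroup.adelic (↥(maximalRealSubfield L)) L (IsCMField.complexConj L) 1 (JW (↥(maximalRealSubfield L)) L a'))
          (↥(UnitaryGroup.adelic (↥(maximalRealSubfield L)) L (IsCMField.complexConj L) 1 (JW (↥(maximalRealSubfield L)) L a')) ⧸
            (UnitaryGroup.toAdelic (↥(maximalRealSubfield L)) L (IsCMField.complexConj L) 1 (JW (↥(maximalRealSubfield L)) L a')).range)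
          _ (borel _) μW ∧
        -- FACE-P: pure tensors `E(a ⊗ Φ_f)`, `a ∈ V`, only
        ∀ (V : Submodule ℂ 𝓢(((Fin (n' + n')) → mixedSpace (Fp L)), ℂ)), FiniteDimensional ℂ V →
          (∀ ainf : UnitaryGroup.arch (Fp L) L (IsCMField.complexConj L) (n + n) (hermD L e dV hdV dW hdW),
            (UnitaryGroup.archToAdelic (Fp L) L (IsCMField.complexConj L) (n + n) (hermD L e dV hdV dW hdW) ainf : HA L e dV hdV dW hdW) ∈ 𝒦.K →
            ∀ a ∈ V, ∃ a'' ∈ V, ∀ f : FinSB (Fp L) (Fin (n' + n')),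
              adelicMpCont.omega (Fp L) (Fin (n' + n')) (gramDA L e' dV hdV (tensorFrame L dW eW dV') (tensorFrame_real L dW hdW eW dV' hdV'))
                  ((doubledWeilRep L e' dV hdV hdV0 (tensorFrame L dW eW dV') (tensorFrame_real L dW hdW eW dV' hdV')
                        (tensorFrame_ne_zero L dW eW dV' hdW0 hdV'0) χb hχbu hχbs)
                    (tensorEmb L e dV hdV dW hdW eW e' dV' hdV'
                      (UnitaryGroup.archToAdelic (Fp L) L (IsCMField.complexConj L) (n + n) (hermD L e dV hdV dW hdW) ainf)))
                  (piSchwartzBruhatEquiv (Fp L) (Fin (n' + n')) (a ⊗ₜ[ℂ] f)) =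
                piSchwartzBruhatEquiv (Fp L) (Fin (n' + n')) (a'' ⊗ₜ[ℂ] f)) →
          ∀ a ∈ V, ∀ (f : FinSB (Fp L) (Fin (n' + n'))),
          ∀ (Pg : Finset ℂ) (Eg : ℂ → HA L e dV hdV dW hdW → ℂ),
            (∀ h : HA L e dV hdV dW hdW, DifferentiableOn ℂ (fun s => Eg s h) {s : ℂ | 0 < s.re}) →
            (∀ (s : ℂ) (h : HA L e dV hdV dW hdW), (n : ℝ) / 2 < s.re →
              Eg s h = (∏ p ∈ Pg, (s - p)) * eisensteinFamilyDelta L e dV hdV dW hdW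
                (fun s₁ h₁ => ((DoubledWeilDetTwist.detChar L e dV hdV hdV0 dW hdW hdW0 α h₁ : ℂˣ) : ℂ) *
                  stdExtension 𝒦 ((((3 : ℕ) : ℂ) - (n : ℂ)) / 2)
                    (swSectionTensor L e dV hdV dW hdW eW e' dV' hdV' hdV0 hdW0 hdV'0
                      (doubledWeilRep L e' dV hdV hdV0 (tensorFrame L dW eW dV') (tensorFrame_real L dW hdW eW dV' hdV')
                        (tensorFrame_ne_zero L dW eW dV' hdW0 hdV'0) χb hχbu hχbs)
                      (piSchwartzBruhatEquiv (Fp L) (Fin (n' + n')) (a ⊗ₜ[ℂ] f))) s₁ h₁) s h) →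
            ∃ Φ' : piSchwartzBruhat (↥(maximalRealSubfield L)) (Fin n''),
              ∀ h : HA L e dV hdV dW hdW,
                resNorm Pg Eg h = @doubledLineThetaLift L _ _ _ 2 1 n e dV hdV dW hdW n'' e₁ hdV0 hdW0 lam⁻¹
                  (K2LiuConjugateSymplecticInv.IsConjugateSymplectic.inv hlam) a' hρ (borel _) μW Φ' fw h) :
    -- ‹FACE-D› (bytes = the hypothesis of ★ `K2LiuFirstTermIdentityDomainReduction.firstTermIdentityOnGenerators_of_domainFace`)
    ∀ (L : Type) [Field L] [NumberField L] [IsCMField L] {n : ℕ} (e : Fin 2 × Fin 1 ≃ Fin n)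
      (dV : Fin 2 → L) (hdV : ∀ i, IsCMField.complexConj L (dV i) = dV i) (hdV0 : ∀ i, dV i ≠ 0)
      (dW : Fin 1 → L) (hdW : ∀ i, IsCMField.complexConj L (dW i) = dW i) (hdW0 : ∀ i, dW i ≠ 0)
      (lam : Literature.NumberTheory.Automorphic.IdeleClassGroup L →ₜ* Circle) (hlam : IsConjugateSymplectic L lam),
      HasWeight L lam 1 →
      ∀ {M' n' : ℕ} (eW : Fin 1 × Fin 3 ≃ Fin M') (e' : Fin 2 × Fin M' ≃ Fin n')
        (dV' : Fin 3 → L) (hdV' : ∀ k, IsCMField.complexConj L (dV' k) = dV' k) (hdV'0 : ∀ k, dV' k ≠ 0)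
        (χb : HeckeCharacter L) (hχbu : χb.IsUnitary) (hχbs : Literature.RepresentationTheory.HarrisKudlaSweet1996.IsSplittingChar L 1 χb)
        (α : UnitaryGroup.adelicOne (Fp L) L (IsCMField.complexConj L) →* ℂˣ) (hα : Continuous α)
        (hαrat : ∀ u : UnitaryGroup.adelicOne (Fp L) L (IsCMField.complexConj L),
          (u : Literature.NumberTheory.GaloisRepresentations.ideleGroup L) ∈ Literature.NumberTheory.GaloisRepresentations.principalIdeles L → α u = 1)
        (_hχD : χb ^ 3 * DoubledWeilDetTwist.ratioHecke L α hα hαrat = toHeckeCharacter L lam⁻¹)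
        (𝒦 : IwasawaDatum L e dV hdV dW hdW) (_h𝒦 : 𝒦.IsStd)
      {n'' : ℕ} (e₁ : Fin (n + n) × Fin 1 ≃ Fin n''),
      ∃ (a' : (↥(maximalRealSubfield L))ˣ)
        (hρ : HasThetaMajorants fun
          (p : ↥(UnitaryGroup.adelic (↥(maximalRealSubfield L)) L (IsCMField.complexConj L) (n + n) (Matrix.diagonal (dD L e dV hdV dW hdW))) ×
            ↥(UnitaryGroup.adelic (↥(maximalRealSubfield L)) L (IsCMField.complexConj L) 1 (JW (↥(maximalRealSubfield L)) L a')))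
          (Ψ : piSchwartzBruhat (↥(maximalRealSubfield L)) (Fin n'')) =>
            pairRep (↥(maximalRealSubfield L)) L (IsCMField.complexConj L) (n + n) 1 e₁ (Matrix.diagonal (dD L e dV hdV dW hdW)) (JW (↥(maximalRealSubfield L)) L a')
              (chiSplittingLine L e₁ (dD L e dV hdV dW hdW) (dD_conj L e dV hdV dW hdW) (dD_ne_zero L e dV hdV dW hdW hdV0 hdW0)
                (toHeckeCharacter L lam⁻¹) (isUnitary_toHeckeCharacter L lam⁻¹)
                ((isOscillatorChar_toHeckeCharacter_iff lam⁻¹).mpr (K2LiuConjugateSymplecticInv.IsConjugateSymplectic.inv hlam)) (TW (↥(maximalRealSubfield L)) a')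
                (isUnit_det_TW (↥(maximalRealSubfield L)) a') (JW (↥(maximalRealSubfield L)) L a') (JW_eq (↥(maximalRealSubfield L)) L a'))
              p Ψ)
        (μW : @Measure (↥(UnitaryGroup.adelic (↥(maximalRealSubfield L)) L (IsCMField.complexConj L) 1 (JW (↥(maximalRealSubfield L)) L a')) ⧸
          (UnitaryGroup.toAdelic (↥(maximalRealSubfield L)) L (IsCMField.complexConj L) 1 (JW (↥(maximalRealSubfield L)) L a')).range) (borel _))
        (fw : C(↥(UnitaryGroup.adelic (↥(maximalRealSubfield L)) L (IsCMField.complexConj L) 1 (JW (↥(maximalRealSubfield L)) L a')) ⧸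
          (UnitaryGroup.toAdelic (↥(maximalRealSubfield L)) L (IsCMField.complexConj L) 1 (JW (↥(maximalRealSubfield L)) L a')).range, ℂ)),
        @IsFiniteMeasure _ (borel _) μW ∧
        @SMulInvariantMeasure
          ↥(UnitaryGroup.adelic (↥(maximalRealSubfield L)) L (IsCMField.complexConj L) 1 (JW (↥(maximalRealSubfield L)) L a'))
          (↥(UnitaryGroup.adelic (↥(maximalRealSubfield L)) L (IsCMField.complexConj L) 1 (JW (↥(maximalRealSubfield L)) L a')) ⧸
            (UnitaryGroup.toAdelic (↥(maximalRealSubfield L)) L (IsCMField.complexConj L) 1 (JW (↥(maximalRealSubfield L)) L a')).range)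
          _ (borel _) μW ∧
        ∀ (V : Submodule ℂ 𝓢(((Fin (n' + n')) → mixedSpace (Fp L)), ℂ)), FiniteDimensional ℂ V →
          (∀ ainf : UnitaryGroup.arch (Fp L) L (IsCMField.complexConj L) (n + n) (hermD L e dV hdV dW hdW),
            (UnitaryGroup.archToAdelic (Fp L) L (IsCMField.complexConj L) (n + n) (hermD L e dV hdV dW hdW) ainf : HA L e dV hdV dW hdW) ∈ 𝒦.K →
            ∀ a ∈ V, ∃ a'' ∈ V, ∀ f : FinSB (Fp L) (Fin (n' + n')),
              adelicMpCont.omega (Fp L) (Fin (n' + n')) (gramDA L e' dV hdV (tensorFrame L dW eW dV') (tensorFrame_real L dW hdW eW dV' hdV'))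
                  ((doubledWeilRep L e' dV hdV hdV0 (tensorFrame L dW eW dV') (tensorFrame_real L dW hdW eW dV' hdV')
                        (tensorFrame_ne_zero L dW eW dV' hdW0 hdV'0) χb hχbu hχbs)
                    (tensorEmb L e dV hdV dW hdW eW e' dV' hdV'
                      (UnitaryGroup.archToAdelic (Fp L) L (IsCMField.complexConj L) (n + n) (hermD L e dV hdV dW hdW) ainf)))
                  (piSchwartzBruhatEquiv (Fp L) (Fin (n' + n')) (a ⊗ₜ[ℂ] f)) =
                piSchwartzBruhatEquiv (Fp L) (Fin (n' + n')) (a'' ⊗ₜ[ℂ] f)) →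
          ∀ (Φ : piSchwartzBruhat (Fp L) (Fin (n' + n'))),
            Φ ∈ Submodule.span ℂ {x : piSchwartzBruhat (Fp L) (Fin (n' + n')) |
              ∃ a ∈ V, ∃ f : FinSB (Fp L) (Fin (n' + n')), x = piSchwartzBruhatEquiv (Fp L) (Fin (n' + n')) (a ⊗ₜ[ℂ] f)} →
          ∀ (Pg : Finset ℂ) (Eg : ℂ → HA L e dV hdV dW hdW → ℂ),
            (∀ h : HA L e dV hdV dW hdW, DifferentiableOn ℂ (fun s => Eg s h) {s : ℂ | 0 < s.re}) →
            (∀ (s : ℂ) (h : HA L e dV hdV dW hdW), (n : ℝ) / 2 < s.re →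
              Eg s h = (∏ p ∈ Pg, (s - p)) * eisensteinFamilyDelta L e dV hdV dW hdW
                (fun s₁ h₁ => ((DoubledWeilDetTwist.detChar L e dV hdV hdV0 dW hdW hdW0 α h₁ : ℂˣ) : ℂ) *
                  stdExtension 𝒦 ((((3 : ℕ) : ℂ) - (n : ℂ)) / 2)
                    (swSectionTensor L e dV hdV dW hdW eW e' dV' hdV' hdV0 hdW0 hdV'0
                      (doubledWeilRep L e' dV hdV hdV0 (tensorFrame L dW eW dV') (tensorFrame_real L dW hdW eW dV' hdV')
                        (tensorFrame_ne_zero L dW eW dV' hdW0 hdV'0) χb hχbu hχbs) Φ) s₁ h₁) s h) →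
            ∃ Φ' : piSchwartzBruhat (↥(maximalRealSubfield L)) (Fin n''),
              ∀ h : HA L e dV hdV dW hdW,
                resNorm Pg Eg h = @doubledLineThetaLift L _ _ _ 2 1 n e dV hdV dW hdW n'' e₁ hdV0 hdW0 lam⁻¹
                  (K2LiuConjugateSymplecticInv.IsConjugateSymplectic.inv hlam) a' hρ (borel _) μW Φ' fw h := by
  intro L _ _ _ n e dV hdV hdV0 dW hdW hdW0 lam hlam hwt M' n' eW e' dV' hdV' hdV'0 χb hχbu hχbs α hα hαrat hχD 𝒦 h𝒦 n'' e₁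
  obtain ⟨a', hρ, μW, fw, hfin, hinv, hpure⟩ :=
    hP L e dV hdV hdV0 dW hdW hdW0 lam hlam hwt eW e' dV' hdV' hdV'0 χb hχbu hχbs α hα hαrat hχD 𝒦 h𝒦 e₁
  refine ⟨a', hρ, μW, fw, hfin, hinv, ?_⟩
  intro V hVfd harch Φ hΦ Pg Eg hhol heq
  haveI : FiniteDimensional ℂ V := hVfd
  -- the theta datum's σ-algebra is the Borel one (socket spelling `(borel _)`); instances for ★ `doubledLineThetaLift_add ∕ _smul`
  letI : MeasurableSpace (↥(UnitaryGroup.adelic (Fp L) L (IsCMField.complexConj L) 1 (JW (Fp L) L a')) ⧸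
      (UnitaryGroup.toAdelic (Fp L) L (IsCMField.complexConj L) 1 (JW (Fp L) L a')).range) := borel _
  haveI : BorelSpace (↥(UnitaryGroup.adelic (Fp L) L (IsCMField.complexConj L) 1 (JW (Fp L) L a')) ⧸
      (UnitaryGroup.toAdelic (Fp L) L (IsCMField.complexConj L) 1 (JW (Fp L) L a')).range) := ⟨rfl⟩
  haveI : IsFiniteMeasure μW := hfin
  -- abbreviations (local `let`s, no definitions): the concrete big splitting, pure tensors, the generator family
  have hsB := isDoubledWeilRep_doubledWeilRep L e' dV hdV hdV0 (tensorFrame L dW eW dV') (tensorFrame_real L dW hdW eW dV' hdV')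
    (tensorFrame_ne_zero L dW eW dV' hdW0 hdV'0) χb hχbu hχbs
  let E : 𝓢(((Fin (n' + n')) → mixedSpace (Fp L)), ℂ) ⊗[ℂ] FinSB (Fp L) (Fin (n' + n')) ≃ₗ[ℂ] piSchwartzBruhat (Fp L) (Fin (n' + n')) :=
    piSchwartzBruhatEquiv (Fp L) (Fin (n' + n'))
  let G : piSchwartzBruhat (Fp L) (Fin (n' + n')) → ℂ → HA L e dV hdV dW hdW → ℂ := fun Ψ s₁ h₁ =>
    ((DoubledWeilDetTwist.detChar L e dV hdV hdV0 dW hdW hdW0 α h₁ : ℂˣ) : ℂ) *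
      stdExtension 𝒦 ((((3 : ℕ) : ℂ) - (n : ℂ)) / 2)
        (swSectionTensor L e dV hdV dW hdW eW e' dV' hdV' hdV0 hdW0 hdV'0
          (doubledWeilRep L e' dV hdV hdV0 (tensorFrame L dW eW dV') (tensorFrame_real L dW hdW eW dV' hdV')
            (tensorFrame_ne_zero L dW eW dV' hdW0 hdV'0) χb hχbu hχbs) Ψ) s₁ h₁
  -- decompose `Φ` along the pure tensors of `D_V`
  obtain ⟨m, c, x, hx⟩ := Submodule.mem_span_set'.1 hΦ
  have hxj : ∀ j : Fin m, ∃ a ∈ V, ∃ f : FinSB (Fp L) (Fin (n' + n')), (x j : piSchwartzBruhat (Fp L) (Fin (n' + n'))) = E (a ⊗ₜ[ℂ] f) :=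
    fun j => (x j).2
  choose a ha f hf using hxj
  have hΦsum : Φ = ∑ j, c j • E (a j ⊗ₜ[ℂ] f j) := by
    rw [← hx]
    exact Finset.sum_congr rfl fun j _ => by rw [hf j]
  -- every pure tensor of `D_V` is `K`-finite (★ U2f ⇒), so its generator is STANDARD for `(𝒦, λ̃⁻¹)` and continuous (★ O42.3g)
  have hKf : ∀ j : Fin m, FiniteDimensional ℂ (Submodule.span ℂ (Set.range fun k : 𝒦.K =>
      adelicMpCont.omega (Fp L) (Fin (n' + n')) (gramDA L e' dV hdV (tensorFrame L dW eW dV') (tensorFrame_real L dW hdW eW dV' hdV'))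
        ((doubledWeilRep L e' dV hdV hdV0 (tensorFrame L dW eW dV') (tensorFrame_real L dW hdW eW dV' hdV')
                (tensorFrame_ne_zero L dW eW dV' hdW0 hdV'0) χb hχbu hχbs)
          (tensorEmb L e dV hdV dW hdW eW e' dV' hdV' (k : HA L e dV hdV dW hdW))) (E (a j ⊗ₜ[ℂ] f j)))) := fun j =>
    finiteDimensional_span_orbit_of_mem_span_tmul_of_isStd L e dV hdV dW hdW eW e' dV' hdV' hdV0 hdW0 hdV'0 h𝒦 hsB V harch
      (Submodule.subset_span ⟨a j, ha j, f j, rfl⟩)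
  have hstd : ∀ j : Fin m, IsStandardSectionFamily 𝒦 (toHeckeCharacter L lam⁻¹) (G (E (a j ⊗ₜ[ℂ] f j))) := by
    intro j
    rw [← hχD]
    exact isStandardSectionFamily_swTensorTwisted L e dV hdV hdV0 dW hdW hdW0 eW e' dV' hdV' hdV'0 α (by norm_num) hsB 𝒦 _ (hKf j) hα hαrat
  have hcont : ∀ (j : Fin m) (s : ℂ), Continuous fun h => G (E (a j ⊗ₜ[ℂ] f j)) s h := fun j s =>
    continuous_swTensorTwisted L e dV hdV hdV0 dW hdW hdW0 eW e' dV' hdV' hdV'0 α (by norm_num) hsB 𝒦 _ (hKf j) hα s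
  -- socket #41 BY VALUE: a pole-cleared continuation of each summand's Eisenstein series
  have hpk : ∀ j : Fin m, ∃ (P : Finset ℂ) (Es : ℂ → HA L e dV hdV dW hdW → ℂ),
      (∀ h : HA L e dV hdV dW hdW, DifferentiableOn ℂ (fun s => Es s h) {s : ℂ | 0 < s.re}) ∧
      (∀ (s : ℂ) (h : HA L e dV hdV dW hdW), (n : ℝ) / 2 < s.re →
        Es s h = (∏ p ∈ P, (s - p)) * eisensteinFamilyDelta L e dV hdV dW hdW (G (E (a j ⊗ₜ[ℂ] f j))) s h) := by
    intro j
    obtain ⟨P, Es, h1, -, -, h4, -⟩ := h41 L e dV hdV hdV0 dW hdW hdW0 lam hlam hwt 𝒦 h𝒦 _ (hstd j) (hcont j)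
    exact ⟨P, Es, h1, h4⟩
  choose P Es hPhol hPeq using hpk
  -- FACE-P on each pure tensor
  have hΦ'j : ∀ j : Fin m, ∃ Φ'j : piSchwartzBruhat (↥(maximalRealSubfield L)) (Fin n''), ∀ h : HA L e dV hdV dW hdW,
      resNorm (P j) (Es j) h = @doubledLineThetaLift L _ _ _ 2 1 n e dV hdV dW hdW n'' e₁ hdV0 hdW0 lam⁻¹
        (K2LiuConjugateSymplecticInv.IsConjugateSymplectic.inv hlam) a' hρ (borel _) μW Φ'j fw h := fun j =>
    hpure V hVfd harch (a j) (ha j) (f j) (P j) (Es j) (hPhol j) (hPeq j)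
  choose Φ' hΦ' using hΦ'j
  -- ★ U0.4: the residue form of `g_Φ = Σ c_j • g_j` along the given `(Pg, Eg)` and the chosen `(P_j, E_j)`
  have hsum := resNorm_finset_sum L e dV hdV hdV0 dW hdW hdW0 (toHeckeCharacter L lam⁻¹) (isUnitary_toHeckeCharacter L lam⁻¹) c
    (fun j => G (E (a j ⊗ₜ[ℂ] f j))) (fun j s => (hstd j).1.1 s) hcont (G Φ)
    (by
      rw [hΦsum]
      exact twistedGen_sum_smul L e dV hdV hdV0 dW hdW hdW0 eW e' dV' hdV' hdV'0 _ 𝒦 _ α c fun j => E (a j ⊗ₜ[ℂ] f j))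
    Pg Eg hhol heq P Es hPhol hPeq
  refine ⟨∑ j, c j • Φ' j, fun h => ?_⟩
  rw [hsum, doubledLineThetaLift_sum_smul]
  exact Finset.sum_congr rfl fun j _ => by rw [hΦ' j h]

end Summit.HodgeConjecture.HodgeConjecture.Cruxes.HLiu418.K2LiuFirstTermIdentityPureTensorReduction

end
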